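import Literature.Barriers.Schanuel.PeriodConjectureOverQbarScope
import Literature.Barriers.Schanuel.AlgebraicIndependenceOfLogarithmsProofs
import HarnessLib

/-!
# Barrier (Schanuel): Grothendieck's period conjecture for toric 1-motives over `ℚ̄` — the proved cases

`Literature/Barriers/Schanuel/ToricPeriodConjectureQbarProofs.lean` — companion to the barrier file
`Literature.Barriers.Schanuel.PeriodConjectureOverQbarScope`, whose named fact
`Literature.Barriers.Schanuel.ToricPeriodConjectureQbar` renders Grothendieck's period conjecture
`(?)`/`(??)` (the conjectural inequality `≥`) for the 1-motives without abelian part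
`M = [ℤʳ → 𝔾ₘⁿ]` over the algebraic subfields `k ⊆ ℚ̄` of `ℂ`. (The barrier's other named
conjecture, `ExpTranscendentalOverPeriodField`, is treated in
`Literature.Barriers.Schanuel.PeriodConjectureOverQbarScopeProofs`.)

## Status of the fact (why there is no `ToricPeriodConjectureQbar_holds`)

The source prints the statement as a conjecture: "Grothendieck's period conjecture. `(?)` If
`k ⊂ ℚ̄`, then `ϖ` maps to the generic point of `Π(M)`. … Therefore `(?)` is equivalent to the
connectedness of `Π(M)`, plus the equality: `(??)` `transc.deg_ℚ k(periods(M)) = dim G_mot(M)`",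
with only "In `(??)`, inequality `≤` is unconditional" [Bertolin2020, appendix (letter of
Y. André)]. For the toric 1-motives it is open: the companion file PROVES
`ToricPeriodConjectureQbar ↔ AlgIndepLogarithms` (`toricPeriodConjectureQbar_iff_algIndepLogarithms`,
Bertolin's (A)/(B) [Bertolin2002, §3.5] with `K` algebraic), and the conjecture of algebraic
independence of logarithms of algebraic numbers is open — "it is not even known whether or not
there exist two elements of `L` which are algebraically independent over `ℚ`" [Roy1992,
Introduction p. 22] (see `Literature.Barriers.Schanuel.AlgebraicIndependenceOfLogarithmsProofs` for
the status of that fact). Hence the fact cannot be discharged from the literature; this file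
records its proved frontier, graded by `dim G_mot(M) = motGaloisDim M`.

## What is proved here

* `gpc_of_algIndepLogarithms_upTo` — **graded (B)**: the conjecture on logarithms for families
  of length `≤ N` gives `(??)` for every toric 1-motive over an algebraic field with
  `dim G_mot(M) ≤ N` (the companion's `gpc_of_algIndepLogarithms` with the dimension tracked: a
  `ℚ`-basis of the periods has `dim G_mot(M)` elements, all logarithms of algebraic numbers
  [Bertolin2002, §3.5 (B)]).
* `gpc_of_motGaloisDim_le_one` — **`(??)` holds unconditionally for all toric `M` over all
  algebraic `k` with `dim G_mot(M) ≤ 1`**: graded (B) at `N = 1` fed with the Hermite–Lindemann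
  case `algIndepLogarithms_of_le_one` ("`log α` is transcendental for algebraic `α` not `0` or
  `1`" [BakerTNT1975, Ch. 1 §3, corollaries of Theorem 1.4, p. 6]; tree:
  `Literature.NumberTheory.Transcendental.transcendental_exp_holds`, discharged from Lindemann–Weierstrass).
* `algebraicIndependent_piI_log_two_of_gpc_upTo_two` — **the next case is open**: `(??)` for the
  toric motives over `ℚ̄` with `dim G_mot(M) ≤ 2` already yields two algebraically independent
  logarithms of algebraic numbers, `iπ = log(−1)` and `log 2` (apply it to `M = [ℤ → 𝔾ₘ²]`,
  `u(1) = (−1, 2)`, over `k = ℚ`, whose periods span `ℚ iπ ⊕ ℚ log 2` inside `ℚ(iπ, log 2)`;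
  this is (A1) of [Bertolin2002, §3.5] for this motive), which is Roy's open question
  [Roy1992, Introduction p. 22].

Nothing is restated: the conjecture, `(A)`, `(B)` and the equivalence live in the companion file;
the Hermite–Lindemann case of the conjecture on logarithms is imported from
`AlgebraicIndependenceOfLogarithmsProofs`.

## References

* [Bertolin2020] C. Bertolin, *Third kind elliptic integrals and 1-motives*, J. Pure Appl.
  Algebra 224 (2020) 106396, arXiv:1905.07247: appendix, letter of Y. André (29 May 2019),
  `(?)`, `(??)` and the Remark "inequality `≤` is unconditional".
* [Bertolin2002] C. Bertolin, *Périodes de 1-motifs et transcendance*, J. Number Theory 97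
  (2002) 204–221: §3.5 (A1), (A2), (B).
* [Roy1992] D. Roy, *Matrices whose coefficients are linear forms in logarithms*, J. Number
  Theory 41 (1992) 22–47: Introduction p. 22.
* [BakerTNT1975] A. Baker, *Transcendental Number Theory* (1975): Ch. 1 §3, Theorem 1.4 and its
  corollaries, p. 6.
-/

noncomputable section

open Complex Cardinal

namespace Literature.Barriers.Schanuel

/-- **Graded (B) over `ℚ̄`**: the conjecture on logarithms for families of length `≤ N` already
gives Grothendieck's conjecture `(??)` for every toric 1-motive over an algebraic field whose
motivic Galois group has dimension `≤ N` (proof of the companion's `gpc_of_algIndepLogarithms`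
with the dimension tracked: a `ℚ`-basis `b ⊆ periods(M)` of their span has
`#b = motGaloisDim M ≤ N` elements, all of them logarithms of algebraic numbers by
`periodSet_subset_logQSpan`, hence algebraically independent inside `k(periods(M))`). PROVED.
[cite: Bertolin2002, §3.5 (B)] -/
theorem gpc_of_algIndepLogarithms_upTo {N : ℕ}
    (h : ∀ n ≤ N, ∀ l : Fin n → ℂ, (∀ i, IsAlgebraic ℚ (cexp (l i))) → LinearIndependent ℚ l →
      AlgebraicIndependent ℚ l)
    {k : IntermediateField ℚ ℂ} (hk : k ≤ algebraicClosure ℚ ℂ) {r n : ℕ}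
    (M : Literature.NumberTheory.Transcendental.OneMotiveToric k r n) (hM : M.motGaloisDim ≤ N) :
    M.GPC := by
  obtain ⟨b, hb, hspan, hli⟩ := exists_linearIndependent ℚ M.periodSet
  have hrank : (M.motGaloisDim : Cardinal) = #b := by
    rw [Literature.NumberTheory.Transcendental.OneMotiveToric.motGaloisDim, Module.finrank_eq_rank,
      ← hspan, rank_span_set hli]
  haveI : Finite b := Cardinal.lt_aleph0_iff_finite.mp (hrank ▸ Cardinal.natCast_lt_aleph0)
  have hcard : Nat.card b = M.motGaloisDim := by
    have h' : ((Nat.card b : ℕ) : Cardinal) = (M.motGaloisDim : Cardinal) := by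
      rw [Nat.cast_card, hrank]
    exact_mod_cast h'
  set e := Finite.equivFin b
  set z : Fin (Nat.card b) → ℂ := fun i => (e.symm i : ℂ)
  have hz : LinearIndependent ℚ z := hli.comp _ e.symm.injective
  have halg : ∀ i, IsAlgebraic ℚ (cexp (z i)) := fun i =>
    mem_logQSpan_iff.mp (periodSet_subset_logQSpan hk M (hb (e.symm i).2))
  have hai : AlgebraicIndependent ℚ z := h _ (hcard ▸ hM) z halg hz
  let z' : Fin (Nat.card b) → M.periodField := fun i =>
    ⟨z i, M.periodSet_subset_periodField (hb (e.symm i).2)⟩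
  have hai' : AlgebraicIndependent ℚ z' :=
    AlgebraicIndependent.of_comp M.periodField.val hai
  rw [Literature.NumberTheory.Transcendental.OneMotiveToric.GPC, hrank, Cardinal.mk_congr e]
  exact hai'.cardinalMk_le_trdeg

/-- **What is proved of `ToricPeriodConjectureQbar`: Grothendieck's period conjecture `(??)`
holds unconditionally for every toric 1-motive `M = [ℤʳ → 𝔾ₘⁿ]` over every algebraic field
`k ⊆ ℚ̄` with `dim G_mot(M) ≤ 1`** (graded (B) at `N = 1` fed with the Hermite–Lindemann case of
the conjecture on logarithms, `algIndepLogarithms_of_le_one`): a non-zero period is `2πi` or a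
logarithm of an algebraic number, hence transcendental, so `trdeg_ℚ k(periods(M)) ≥ 1`. PROVED.
[cite: BakerTNT1975, Ch. 1 §3, corollaries of Theorem 1.4, p. 6] [cite: Bertolin2002, §3.5 (B)] -/
theorem gpc_of_motGaloisDim_le_one {k : IntermediateField ℚ ℂ} (hk : k ≤ algebraicClosure ℚ ℂ)
    {r n : ℕ} (M : Literature.NumberTheory.Transcendental.OneMotiveToric k r n)
    (hM : M.motGaloisDim ≤ 1) : M.GPC :=
  gpc_of_algIndepLogarithms_upTo (fun _ hn l halg hl => algIndepLogarithms_of_le_one hn l halg hl)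
    hk M hM

/-- **The next case is open: `(??)` for the toric 1-motives over `ℚ̄` with `dim G_mot(M) ≤ 2`
already yields two algebraically independent logarithms of algebraic numbers**, namely
`iπ = log(−1)` and `log 2`: apply it to `M = [ℤ → 𝔾ₘ²]`, `u(1) = (−1, 2)`, over `k = ℚ` — every
period is a `ℚ`-combination of `iπ` and `log 2` (`2πi = 2·iπ`, the logarithms of `−1` and `2` are
`iπ + 2πiℤ` and `log 2 + 2πiℤ`), and conversely, so `dim G_mot(M) = 2`
(`linearIndependent_piI_log_two`) and `k(periods(M)) ⊆ ℚ(iπ, log 2)`, whence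
`trdeg ℚ(iπ, log 2) ≥ 2` — whereas "it is not even known whether or not there exist two elements
of `L` which are algebraically independent over `ℚ`". PROVED (the implication); compare the
companion's `algebraicIndependent_piI_log_two_of_algIndepLogarithms`.
[cite: Roy1992, Introduction p. 22] [cite: Bertolin2002, §3.5 (A1)] -/
theorem algebraicIndependent_piI_log_two_of_gpc_upTo_two
    (h : ∀ (k : IntermediateField ℚ ℂ), k ≤ algebraicClosure ℚ ℂ →
      ∀ (r n : ℕ) (M : Literature.NumberTheory.Transcendental.OneMotiveToric k r n),
        M.motGaloisDim ≤ 2 → M.GPC) :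
    AlgebraicIndependent ℚ ![(Real.pi : ℂ) * I, (Real.log 2 : ℂ)] := by
  set v : Fin 2 → ℂ := ![(Real.pi : ℂ) * I, (Real.log 2 : ℂ)] with hv
  -- the motive `[ℤ → 𝔾ₘ²]`, `u(1) = (-1, 2)`, over `ℚ = ⊥`
  have hexp : ∀ j, cexp (v j) = ![(-1 : ℂ), 2] j := by
    intro j
    fin_cases j
    · simp [hv, Complex.exp_pi_mul_I]
    · simp only [hv, Fin.mk_one, Fin.isValue, Matrix.cons_val_one, Matrix.cons_val_fin_one]
      rw [← Complex.ofReal_exp, Real.exp_log two_pos]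
      simp
  have hmem : ∀ j, (![(-1 : ℂ), 2] j) ∈ (⊥ : IntermediateField ℚ ℂ) := by
    intro j
    fin_cases j <;> simp
  have hne : ∀ j, (![(-1 : ℂ), 2] j) ≠ 0 := by
    intro j
    fin_cases j <;> simp
  let M : Literature.NumberTheory.Transcendental.OneMotiveToric (⊥ : IntermediateField ℚ ℂ) 1 2 :=
    ⟨fun _ j => ![(-1 : ℂ), 2] j, fun _ j => hmem j, fun _ j => hne j⟩
  -- every period is a `ℚ`-combination of `iπ` and `log 2`, and conversely
  have h2pi : (2 * Real.pi * I : ℂ) ∈ Submodule.span ℚ (Set.range v) := by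
    have : (2 * Real.pi * I : ℂ) = (2 : ℚ) • v 0 := by
      simp [hv, Rat.smul_def]; ring
    rw [this]
    exact Submodule.smul_mem _ _ (Submodule.subset_span ⟨0, rfl⟩)
  have hsub : M.periodSet ⊆ Submodule.span ℚ (Set.range v) := by
    rintro p (⟨-, rfl⟩ | ⟨i, j, hp⟩)
    · exact h2pi
    · change cexp p = ![(-1 : ℂ), 2] j at hp
      rw [← hexp j] at hp
      obtain ⟨m, rfl⟩ := Complex.exp_eq_exp_iff_exists_int.1 hp
      refine add_mem (Submodule.subset_span ⟨j, rfl⟩) ?_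
      have : (m : ℂ) * (2 * Real.pi * I) = (m : ℚ) • (2 * Real.pi * I : ℂ) := by
        simp [Rat.smul_def]
      rw [this]
      exact Submodule.smul_mem _ _ h2pi
  have hspan_le : Submodule.span ℚ M.periodSet ≤ Submodule.span ℚ (Set.range v) :=
    Submodule.span_le.mpr hsub
  have hspan_ge : Submodule.span ℚ (Set.range v) ≤ Submodule.span ℚ M.periodSet := by
    refine Submodule.span_le.mpr ?_
    rintro _ ⟨j, rfl⟩
    fin_cases j
    · -- `iπ = ½ · 2πi`
      have : v 0 = (1 / 2 : ℚ) • (2 * Real.pi * I : ℂ) := by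
        simp [hv, Rat.smul_def]; ring
      simpa [this] using Submodule.smul_mem _ (1 / 2 : ℚ)
        (Submodule.subset_span (M.two_pi_I_mem_periodSet two_ne_zero))
    · exact Submodule.subset_span (M.logSet_subset_periodSet ⟨0, 1, hexp 1⟩)
  have hspan : Submodule.span ℚ M.periodSet = Submodule.span ℚ (Set.range v) :=
    le_antisymm hspan_le hspan_ge
  have hdim : (M.motGaloisDim : Cardinal) = 2 := by
    rw [Literature.NumberTheory.Transcendental.OneMotiveToric.motGaloisDim, Module.finrank_eq_rank, hspan,
      rank_span_set (linearIndependent_piI_log_two.linearIndepOn_id), Cardinal.mk_range_eq v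
        linearIndependent_piI_log_two.injective, Cardinal.mk_fin]
    norm_num
  have hdim' : M.motGaloisDim ≤ 2 := by exact_mod_cast hdim.le
  have hM : (M.motGaloisDim : Cardinal) ≤ Algebra.trdeg ℚ M.periodField := h ⊥ bot_le 1 2 M hdim'
  -- the period field lies in `ℚ(iπ, log 2)`
  set E := IntermediateField.adjoin ℚ (Set.range v) with hEdef
  have hE : M.periodField ≤ E := by
    -- `E` as an intermediate field over the base `k = ℚ` (`= ⊥`) of `M`
    let E' : IntermediateField (⊥ : IntermediateField ℚ ℂ) ℂ :=
      E.toSubfield.toIntermediateField fun x => by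
        obtain ⟨q, hq⟩ := IntermediateField.mem_bot.mp x.2
        change (x : ℂ) ∈ E
        rw [← hq]
        exact E.algebraMap_mem q
    have hle : IntermediateField.adjoin (⊥ : IntermediateField ℚ ℂ) M.periodSet ≤ E' := by
      rw [IntermediateField.adjoin_le_iff]
      intro p hp
      have hle' : Submodule.span ℚ (Set.range v) ≤ E.toSubalgebra.toSubmodule :=
        Submodule.span_le.mpr fun x hx => IntermediateField.subset_adjoin ℚ _ hx
      exact hle' (hsub hp)
    intro z hz
    exact hle ((M.mem_periodField_iff).mp hz)
  have key := hM.trans (Literature.NumberTheory.Transcendental.OneMotiveToric.trdeg_mono hE)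
  rw [hdim] at key
  exact algebraicIndependent_of_le_trdeg_adjoin v (by exact_mod_cast key)

end Literature.Barriers.Schanuel
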